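import Mathlib.Data.Finset.Card
import Mathlib.Tactic.Linarith
import Mathlib.Tactic.Ring
import HarnessLib

/-!
# Three boundary neighbourhoods: a Bonferroni count (the 'pair law' reduction for 3-thread bundles)

Support file (`--supports stmt-CriticalPhenomena-4575`, closed), prover `prim-cplus-coupling` (gen 54).  No definitions, no notations, no named facts,
no sorries; standard axioms.  Memo `prim-cplus-coupling/A5-COUPLING-gen54.md` §3.2.

On a 3-thread bundle every source `σ` has a nonempty set `Empty(σ) ⊊ {0,1,2}` of all-blue threads; THEOREM BI (gen 45/46,
`Coefficientwise.bundle_boundary_count`) controls, for each thread `e`, the sources with `e ∈ Empty` by the `e`-full supply above them.  The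
abstract counting step that turns the three boundary inequalities into ONE Hall inequality is isolated here:
`Coefficientwise.card_union₃_le_of_pairLaw` — if `S = S₀ ∪ S₁ ∪ S₂` with `S₀ ∩ S₁ ∩ S₂ = ∅` and the 'pair law' `#(S_e ∖ S_e′) ≤ #(N_e ∖ N_e′)` holds along
a cyclic orientation (three ordered pairs), then `#S ≤ #(N₀ ∪ N₁ ∪ N₂)`.  Proof: three-set inclusion–exclusion (Bonferroni) on both sides.
[cite: KozmaNitzan2024, Questions 8–9 (§5.5 p. 36) (context)]
-/

namespace Summit.CriticalPhenomena.PercolationContinuityZ3.Theorems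

namespace Coefficientwise

variable {α β : Type*} [DecidableEq α] [DecidableEq β]

/-- Three-set inclusion–exclusion as an upper bound: `#(A ∪ B ∪ C) + #(A∩B) + #(A∩C) + #(B∩C) ≤ #A + #B + #C + #(A ∩ B ∩ C)` (in fact equality). [folklore] -/
theorem card_union₃_add_le (A B C : Finset α) :
    (A ∪ B ∪ C).card + (A ∩ B).card + (A ∩ C).card + (B ∩ C).card ≤ A.card + B.card + C.card + (A ∩ B ∩ C).card := by
  have h1 := Finset.card_union_add_card_inter (A ∪ B) C
  have h2 := Finset.card_union_add_card_inter A B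
  have h3 : ((A ∪ B) ∩ C) = (A ∩ C) ∪ (B ∩ C) := Finset.union_inter_distrib_right A B C
  have h4 := Finset.card_union_add_card_inter (A ∩ C) (B ∩ C)
  have h5 : (A ∩ C) ∩ (B ∩ C) = A ∩ B ∩ C := by
    ext x; simp only [Finset.mem_inter]; tauto
  rw [h3] at h1
  rw [h5] at h4
  omega

/-- Three-set Bonferroni lower bound: `#A + #B + #C ≤ #(A ∪ B ∪ C) + #(A∩B) + #(A∩C) + #(B∩C)`. [folklore] -/
theorem card_add₃_le_union_add_inters (A B C : Finset β) :
    A.card + B.card + C.card ≤ (A ∪ B ∪ C).card + (A ∩ B).card + (A ∩ C).card + (B ∩ C).card := by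
  have h1 := Finset.card_union_add_card_inter (A ∪ B) C
  have h2 := Finset.card_union_add_card_inter A B
  have h3 : ((A ∪ B) ∩ C) = (A ∩ C) ∪ (B ∩ C) := Finset.union_inter_distrib_right A B C
  have h4 : ((A ∩ C) ∪ (B ∩ C)).card ≤ (A ∩ C).card + (B ∩ C).card := Finset.card_union_le _ _
  rw [h3] at h1
  omega

/-- **Cyclic pair law ⟹ union bound.**  Sources `S₀, S₁, S₂` (classes 'thread e empty', no source in all three) and supplies `N₀, N₁, N₂` (the three
boundary neighbourhoods).  If along ONE cyclic orientation `0→1→2→0` the sources of class `e` outside class `e′` are at most the `e`-supply outside the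
`e′`-supply, then all sources together are at most the total supply: `#(S₀ ∪ S₁ ∪ S₂) ≤ #(N₀ ∪ N₁ ∪ N₂)` (three of the six ordered pairs suffice; by symmetry
the other orientation `(1,0),(2,1),(0,2)` works as well).  With THEOREM BI's neighbourhoods this is Hall's condition for the IET matching on a 3-thread
bundle (memo §3.2). -/
theorem card_union₃_le_of_pairLaw (S₀ S₁ S₂ : Finset α) (N₀ N₁ N₂ : Finset β)
    (h012 : S₀ ∩ S₁ ∩ S₂ = ∅)
    (p01 : (S₀ \ S₁).card ≤ (N₀ \ N₁).card) (p12 : (S₁ \ S₂).card ≤ (N₁ \ N₂).card) (p20 : (S₂ \ S₀).card ≤ (N₂ \ N₀).card) :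
    (S₀ ∪ S₁ ∪ S₂).card ≤ (N₀ ∪ N₁ ∪ N₂).card := by
  -- sdiff cards in terms of intersections
  have eS01 := Finset.card_sdiff_add_card_inter S₀ S₁
  have eS12 := Finset.card_sdiff_add_card_inter S₁ S₂
  have eS20 := Finset.card_sdiff_add_card_inter S₂ S₀
  have eN01 := Finset.card_sdiff_add_card_inter N₀ N₁
  have eN12 := Finset.card_sdiff_add_card_inter N₁ N₂
  have eN20 := Finset.card_sdiff_add_card_inter N₂ N₀
  have cS10 : (S₁ ∩ S₀).card = (S₀ ∩ S₁).card := by rw [Finset.inter_comm]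
  have cS20 : (S₂ ∩ S₀).card = (S₀ ∩ S₂).card := by rw [Finset.inter_comm]
  have cS21 : (S₂ ∩ S₁).card = (S₁ ∩ S₂).card := by rw [Finset.inter_comm]
  have cN10 : (N₁ ∩ N₀).card = (N₀ ∩ N₁).card := by rw [Finset.inter_comm]
  have cN20 : (N₂ ∩ N₀).card = (N₀ ∩ N₂).card := by rw [Finset.inter_comm]
  have cN21 : (N₂ ∩ N₁).card = (N₁ ∩ N₂).card := by rw [Finset.inter_comm]
  -- inclusion–exclusion on both sides
  have hS := card_union₃_add_le S₀ S₁ S₂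
  have hN := card_add₃_le_union_add_inters N₀ N₁ N₂
  have h0 : (S₀ ∩ S₁ ∩ S₂).card = 0 := by rw [h012]; rfl
  omega

end Coefficientwise

end Summit.CriticalPhenomena.PercolationContinuityZ3.Theorems
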